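import Mathlib
import Literature.Topology.FourManifolds.LefschetzHandlebody
import Literature.AlgebraicTopology.SingularHomology.IntersectionFormProofs
import Literature.AlgebraicTopology.SingularHomology.BoundaryManifoldFiniteness
import Literature.Topology.FourManifolds.LefschetzBaseBetti
import Literature.Topology.FourManifolds.LefschetzModelFacts
import Literature.GroupTheory.CombinatorialGroupTheory.SignedHurwitzAction
import Summits.SmoothPoincare4.SmoothPoincare4.Theorems.ConvexBisectionAcyclicBisectionExistsStubLefschetzHandlebodyConnected
import Summits.SmoothPoincare4.SmoothPoincare4.Theorems.ConvexBisectionAcyclicBisectionExistsMultiAttachmentH1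
import Summits.SmoothPoincare4.SmoothPoincare4.Theorems.ConvexBisectionAcyclicBisectionExistsMultiAttachmentHk
import HarnessLib

/-!
# NF5 `LefschetzBase.isLefschetzHandlebody_homology`: the homology of the Lefschetz handlebody
# `X(F_{g,1}; l)` — clause 3 (`ℚ`-acyclicity when the `2g` vanishing cycles span) and the assembly
(helper for stub `stub_isLefschetzHandlebody_homology` = NF5
`Literature.Topology.FourManifolds.LefschetzBase.isLefschetzHandlebody_homology`, line
`modp-braid-orbits` r9, crux `ConvexBisection.AcyclicBisectionExists`, item stmt-SmoothPoincare4-10508;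
wave 3 / W3-2)

Gompf–Stipsicz 1999, §8.2 / Kas 1980: `X(F; l)` is `F × D²` with one 2-handle per vanishing cycle,
so `H₁(X; ℤ) = ℤ^{2g}/⟨cycles⟩` and `H₂`, `H₃`, … do not grow when the cycles are independent.
Over the concrete base this is assembled from the multi-attachment engine INTEGRALLY and then read
over `ℚ` through Betti numbers (`bₖ(X; ℤ) = bₖ(X; ℚ)`, Hatcher Cor. 3A.6 (a), tree
`bettiNumber_int_eq_rat`; finite generation of `Hₖ` of a compact manifold with boundary,
`finite_singularHomology_of_compact_chartedSpace_halfSpace`), which avoids rational Hurewicz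
classes altogether:

* §1 algebra: if the letters of `l`, read over `ℚ`, span `ℚ^{2g}` and `l` has length `2g`, then
  the letters `i ↦ (l.get i).1` are `ℤ`-linearly independent (`linearIndependent_int_get`), so the
  integral attaching classes of a Lefschetz link realising `l` are independent in `H₁(Base g; ℤ)`
  (`IsLefschetzLink.shadow_eq`: the shadow `shadowMap g` carries them to the letters), and
  `ℤ^{2g} ⧸ span (letters l)` has rank `0` (rank–nullity over `ℤ`);
* §2 **`isLefschetzHandlebody_bettiNumber`**: `b₁(X; ℤ) = 0` (E1 = clause 2,
  `stub_isLefschetzHandlebody_homology_H1`) and `bₖ₊₂(X; ℤ) = bₖ₊₂(Base g; ℤ)` (E2,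
  `IsMultiAttachment.nonempty_iso_of_linearIndependent`); integrally `Hₖ₊₂(X; ℤ) = 0`
  (`isLefschetzHandlebody_isZero_int_add_two`) and, for every word, `Hₖ₊₃(X; R) = 0`
  (`isLefschetzHandlebody_isZero_add_three`);
* §3 **`stub_isLefschetzHandlebody_homology_acyclic_of_base`** (registered sub-goal stub): clause 3
  of NF5 for every genus and word, CONDITIONAL only on `Hₖ₊₂(Base g; ℚ) = 0` for all `k`
  (`Base g ≃ F_{g,1} × D²`; the companion worker's Betti numbers of the base);
* §4 **`stub_isLefschetzHandlebody_homology_of_base`**: all of NF5 modulo that vanishing;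
* §5 **`stub_isLefschetzHandlebody_homology`, `isLefschetzHandlebody_homology_holds`: NF5 PROVED**, the
  vanishing being `isZero_singularHomology_base_of_two_le` (`LefschetzBaseBetti.lean`, wave 3).

Everything is proved; no named facts, no `sorry`, no definitions.  References: R. E. Gompf,
A. I. Stipsicz, *4-Manifolds and Kirby Calculus* (1999), §8.2 [GompfStipsicz1999]; A. Kas,
Pacific J. Math. 89 (1980) [Kas1980]; A. Hatcher, *Algebraic Topology* (2002), §3.A Cor. 3A.6
[HatcherAT2002].
-/

noncomputable section

-- the prescribed namespace `Summit.<P>.<Sub>.…` duplicates `SmoothPoincare4` (P = Sub)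
set_option linter.dupNamespace false

open scoped Manifold ContDiff Topology
open Set Function CategoryTheory CategoryTheory.Limits
open Literature.AlgebraicTopology.SingularHomology
open Literature.Topology.FourManifolds Literature.Topology.FourManifolds.LefschetzBase
open Literature.GroupTheory.CombinatorialGroupTheory.SignedHurwitz (letters ratWord mapWord letters_mapWord)

namespace Summit.SmoothPoincare4.SmoothPoincare4.Theorems.AcyclicBisectionExists.ModpBraidOrbits

/-! ## §1 Spanning rational letters of length `2g` are integrally independent -/

/-- **If the `2g` letters of `l` span `ℚ^{2g}` rationally, they are `ℤ`-linearly independent**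
(a spanning family of `dim` vectors is a basis; independence descends along `ℤ^{2g} → ℚ^{2g}`).
[folklore] -/
theorem linearIndependent_int_get {g : ℕ} (l : List ((Fin g ⊕ Fin g → ℤ) × Bool))
    (hspan : Submodule.span ℚ (letters (ratWord l)) = ⊤) (hlen : l.length = 2 * g) :
    LinearIndependent ℤ fun i : Fin l.length => (l.get i).1 := by
  -- the coordinatewise cast `ℤ^{2g} → ℚ^{2g}` as a `ℤ`-linear map
  let c : (Fin g ⊕ Fin g → ℤ) →ₗ[ℤ] (Fin g ⊕ Fin g → ℚ) :=
    ((Int.castRingHom ℚ).compLeft (Fin g ⊕ Fin g)).toAddMonoidHom.toIntLinearMap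
  have hc : ∀ v : Fin g ⊕ Fin g → ℤ, c v = fun i => (v i : ℚ) := fun v => rfl
  have hletters : letters (ratWord l) = c '' letters l := by
    rw [ratWord, letters_mapWord]
    exact congrArg (fun φ : (Fin g ⊕ Fin g → ℤ) → (Fin g ⊕ Fin g → ℚ) => φ '' letters l)
      (funext fun v => (hc v).symm)
  have hrange : range (c ∘ fun i : Fin l.length => (l.get i).1) = letters (ratWord l) := by
    rw [range_comp, range_get_fst_eq_letters, hletters]
  have hliQ : LinearIndependent ℚ (c ∘ fun i : Fin l.length => (l.get i).1) := by
    refine linearIndependent_of_top_le_span_of_card_eq_finrank (by rw [hrange, hspan]) ?_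
    rw [Fintype.card_fin, hlen, Module.finrank_fintype_fun_eq_card, Fintype.card_sum, Fintype.card_fin]
    ring
  have hliZ : LinearIndependent ℤ (c ∘ fun i : Fin l.length => (l.get i).1) :=
    hliQ.restrict_scalars (R := ℤ) (fun r s h => by simpa using h)
  exact LinearIndependent.of_comp c hliZ

/-- **The integral attaching classes of a Lefschetz link with spanning rational shadows of length
`2g` are linearly independent in `H₁(Base g; ℤ)`** (the homology shadow carries them to the
letters). [cite: GompfStipsicz1999, §8.2] -/
theorem IsLefschetzLink.linearIndependent_loopClass {g : ℕ} {l : List ((Fin g ⊕ Fin g → ℤ) × Bool)}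
    {h : Fin l.length → HandleAttachingMap 3 2 (Base g)} (hl : IsLefschetzLink g l h)
    (hspan : Submodule.span ℚ (letters (ratWord l)) = ⊤) (hlen : l.length = 2 * g) :
    LinearIndependent ℤ fun i => loopClass ℤ ℤ (1 : ℤ)
      (loopPath (h i).attachingCircle (h i).continuous_attachingCircle) := by
  refine LinearIndependent.of_comp (shadowMap g) ?_
  have e : (shadowMap g) ∘ (fun i => loopClass ℤ ℤ (1 : ℤ)
      (loopPath (h i).attachingCircle (h i).continuous_attachingCircle)) =
      fun i : Fin l.length => (l.get i).1 := funext fun i => hl.shadow_eq i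
  rw [e]
  exact linearIndependent_int_get l hspan hlen

/-- **`ℤ^{2g} ⧸ span (letters l)` has rank `0`** when the letters span rationally and `l` has
length `2g` (rank–nullity over `ℤ`: the span has rank `2g`). [folklore] -/
theorem finrank_quotient_span_letters_eq_zero {g : ℕ} (l : List ((Fin g ⊕ Fin g → ℤ) × Bool))
    (hspan : Submodule.span ℚ (letters (ratWord l)) = ⊤) (hlen : l.length = 2 * g) :
    Module.finrank ℤ ((Fin g ⊕ Fin g → ℤ) ⧸ Submodule.span ℤ (letters l)) = 0 := by
  have hli := linearIndependent_int_get l hspan hlen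
  have hN : Module.finrank ℤ (Submodule.span ℤ (letters l)) = 2 * g := by
    rw [← range_get_fst_eq_letters, finrank_span_eq_card hli, Fintype.card_fin, hlen]
  have hM : Module.finrank ℤ (Fin g ⊕ Fin g → ℤ) = 2 * g := by
    rw [Module.finrank_fintype_fun_eq_card, Fintype.card_sum, Fintype.card_fin]; ring
  have h := (Submodule.span ℤ (letters l)).finrank_quotient_add_finrank
  rw [hN, hM] at h
  exact Nat.add_right_cancel (h.trans (zero_add (2 * g)).symm)

/-! ## §2 The integral Betti numbers of a Lefschetz handlebody -/

/-- **Integral Betti numbers of `X(F_{g,1}; l)` with spanning rational shadows of length `2g`**: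
`b₁(X; ℤ) = 0` (E1: `H₁(X; ℤ) ≅ ℤ^{2g}/⟨letters⟩` is torsion) and `bₖ₊₂(X; ℤ) = bₖ₊₂(Base g; ℤ)`
(E2 with independent attaching classes). [cite: GompfStipsicz1999, §8.2] -/
theorem isLefschetzHandlebody_bettiNumber (g : ℕ) (l : List ((Fin g ⊕ Fin g → ℤ) × Bool))
    (X : Type) [TopologicalSpace X] [T2Space X] [SecondCountableTopology X] [CompactSpace X]
    [ChartedSpace (EuclideanHalfSpace 4) X] [IsManifold (𝓡∂ 4) ∞ X]
    (hX : IsLefschetzHandlebody g l X) (hspan : Submodule.span ℚ (letters (ratWord l)) = ⊤)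
    (hlen : l.length = 2 * g) :
    bettiNumber ℤ X 1 = 0 ∧ ∀ k, bettiNumber ℤ X (k + 2) = bettiNumber ℤ (Base g) (k + 2) := by
  refine ⟨?_, fun k => ?_⟩
  · obtain ⟨e⟩ := stub_isLefschetzHandlebody_homology_H1 g l X hX
    rw [bettiNumber, e.finrank_eq, finrank_quotient_span_letters_eq_zero l hspan hlen]
  · obtain ⟨h, hlink, hmulti⟩ := hX
    obtain ⟨e⟩ := IsMultiAttachment.nonempty_iso_of_linearIndependent ℤ hmulti
      (IsLefschetzLink.linearIndependent_loopClass hlink hspan hlen) k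
    rw [bettiNumber, bettiNumber, e.toLinearEquiv.finrank_eq]

/-- **Integral vanishing: `Hₖ₊₂(X(F_{g,1}; l); ℤ) = 0`** when the letters span rationally and
`l` has `2g` letters (E2 over `ℤ` and `Hₖ₊₂(Base g; ℤ) = 0`, `LefschetzBaseBetti.lean`) — the
integral form of Gompf–Stipsicz 1999, §8.2: `H₂(X) ≅ ker(ℤ^{2g} → H₁(F)) = 0`, no `3`-handles.
[cite: GompfStipsicz1999, §8.2] -/
theorem isLefschetzHandlebody_isZero_int_add_two {g : ℕ} {l : List ((Fin g ⊕ Fin g → ℤ) × Bool)}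
    {X : Type} [TopologicalSpace X] [ChartedSpace (EuclideanHalfSpace 4) X]
    (hX : IsLefschetzHandlebody g l X) (hspan : Submodule.span ℚ (letters (ratWord l)) = ⊤)
    (hlen : l.length = 2 * g) (k : ℕ) : IsZero (singularHomology ℤ ℤ X (k + 2)) := by
  obtain ⟨h, hlink, hmulti⟩ := hX
  obtain ⟨e⟩ := IsMultiAttachment.nonempty_iso_of_linearIndependent ℤ hmulti
    (IsLefschetzLink.linearIndependent_loopClass hlink hspan hlen) k
  exact (isZero_singularHomology_base_of_two_le ℤ ℤ g (Nat.le_add_left 2 k)).of_iso e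

/-- **`Hₖ₊₃(X(F_{g,1}; l); R) = 0` for EVERY Lefschetz handlebody over the standard base** (no
hypothesis on the word: the handles are 2-handles and `Hₖ₊₃(Base g; R) = 0`).
[cite: GompfStipsicz1999, §8.2] -/
theorem isLefschetzHandlebody_isZero_add_three (R : Type) [CommRing R] {g : ℕ}
    {l : List ((Fin g ⊕ Fin g → ℤ) × Bool)} {X : Type} [TopologicalSpace X]
    [ChartedSpace (EuclideanHalfSpace 4) X] (hX : IsLefschetzHandlebody g l X) (k : ℕ) :
    IsZero (singularHomology R R X (k + 3)) := by
  obtain ⟨h, -, hmulti⟩ := hX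
  obtain ⟨e⟩ := IsMultiAttachment.nonempty_iso_add_three R hmulti k
  exact (isZero_singularHomology_base_of_two_le R R g (by omega)).of_iso e

/-! ## §3 Clause 3 of NF5 modulo the vanishing of `Hₖ₊₂(Base g; ℚ)` -/

/-- **Clause 3 of NF5 (`LefschetzBase.isLefschetzHandlebody_homology`) modulo the base**
(registered sub-goal stub `stub_isLefschetzHandlebody_homology_acyclic_of_base` of
`stub_isLefschetzHandlebody_homology`): if `Hₖ₊₂(Base g; ℚ) = 0` for all `k` (the base is
`F_{g,1} × D²` on paper), then every Lefschetz handlebody `X(F_{g,1}; l)` whose letters span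
`ℚ^{2g}` rationally and which has `2g` letters is `ℚ`-acyclic in positive degrees — through the
integral Betti numbers of §2, `bₖ(X; ℤ) = bₖ(X; ℚ)` (Hatcher Cor. 3A.6 (a)) and the finite
generation of `Hₖ(X; ℚ)` for the compact manifold with boundary `X`.
[cite: GompfStipsicz1999, §8.2] [cite: HatcherAT2002, §3.A Cor. 3A.6 (a)] -/
theorem stub_isLefschetzHandlebody_homology_acyclic_of_base :
    ∀ (g : ℕ) (l : List ((Fin g ⊕ Fin g → ℤ) × Bool)) (X : Type) [TopologicalSpace X] [T2Space X]
      [SecondCountableTopology X] [CompactSpace X] [ChartedSpace (EuclideanHalfSpace 4) X]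
      [IsManifold (𝓡∂ 4) ∞ X],
      Literature.Topology.FourManifolds.LefschetzBase.IsLefschetzHandlebody g l X →
      (∀ k, CategoryTheory.Limits.IsZero
        (Literature.AlgebraicTopology.SingularHomology.singularHomology ℚ ℚ
          (Literature.Topology.FourManifolds.LefschetzBase.Base g) (k + 2))) →
      Submodule.span ℚ (Literature.GroupTheory.CombinatorialGroupTheory.SignedHurwitz.letters
        (Literature.GroupTheory.CombinatorialGroupTheory.SignedHurwitz.ratWord l)) = ⊤ →
      l.length = 2 * g →
        ∀ k, 0 < k → CategoryTheory.Limits.IsZero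
          (Literature.AlgebraicTopology.SingularHomology.singularHomology ℚ ℚ X k) := by
  intro g l X _ _ _ _ _ _ hX hBase hspan hlen k hk
  obtain ⟨h1, hk2⟩ := isLefschetzHandlebody_bettiNumber g l X hX hspan hlen
  -- the rational Betti number vanishes
  have hb : bettiNumber ℚ X k = 0 := by
    rw [← bettiNumber_int_eq_rat]
    obtain ⟨k, rfl⟩ := Nat.exists_eq_add_one_of_ne_zero hk.ne'
    cases k with
    | zero => exact h1
    | succ k =>
      rw [show k + 1 + 1 = k + 2 from rfl, hk2 k, bettiNumber_int_eq_rat, bettiNumber]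
      exact finrank_eq_zero_of_isZero (hBase k)
  -- `Hₖ(X; ℚ)` is finite-dimensional, hence zero
  haveI : Module.Finite ℚ (singularHomology ℚ ℚ X k) :=
    finite_singularHomology_of_compact_chartedSpace_halfSpace ℚ ℚ (n := 3) k
  haveI : Subsingleton (singularHomology ℚ ℚ X k) := Module.finrank_zero_iff.1 hb
  exact ModuleCat.isZero_of_subsingleton _

/-! ## §4 NF5 modulo the base -/

/-- **NF5 = `LefschetzBase.isLefschetzHandlebody_homology`, all three clauses, MODULO the
vanishing `Hₖ₊₂(Base g; ℚ) = 0`** (registered sub-goal stub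
`stub_isLefschetzHandlebody_homology_of_base`): clause 1 is
`stub_isLefschetzHandlebody_homology_connected` (wave 1), clause 2 is
`stub_isLefschetzHandlebody_homology_H1`, clause 3 is
`stub_isLefschetzHandlebody_homology_acyclic_of_base`; the conclusion is the registered text of
`stub_isLefschetzHandlebody_homology` verbatim. [cite: GompfStipsicz1999, §8.2] [cite: Kas1980] -/
theorem stub_isLefschetzHandlebody_homology_of_base :
    (∀ g k : ℕ, CategoryTheory.Limits.IsZero
      (Literature.AlgebraicTopology.SingularHomology.singularHomology ℚ ℚ
        (Literature.Topology.FourManifolds.LefschetzBase.Base g) (k + 2))) →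
    ∀ (g : ℕ) (l : List ((Fin g ⊕ Fin g → ℤ) × Bool)) (X : Type) [TopologicalSpace X] [T2Space X]
      [SecondCountableTopology X] [CompactSpace X] [ChartedSpace (EuclideanHalfSpace 4) X]
      [IsManifold (𝓡∂ 4) ∞ X],
      Literature.Topology.FourManifolds.LefschetzBase.IsLefschetzHandlebody g l X →
      ConnectedSpace X ∧
        Nonempty ((Literature.AlgebraicTopology.SingularHomology.singularHomology ℤ ℤ X 1) ≃ₗ[ℤ]
          ((Fin g ⊕ Fin g → ℤ) ⧸ Submodule.span ℤ
            (Literature.GroupTheory.CombinatorialGroupTheory.SignedHurwitz.letters l))) ∧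
        (Submodule.span ℚ (Literature.GroupTheory.CombinatorialGroupTheory.SignedHurwitz.letters
            (Literature.GroupTheory.CombinatorialGroupTheory.SignedHurwitz.ratWord l)) = ⊤ →
          l.length = 2 * g → ∀ k, 0 < k → CategoryTheory.Limits.IsZero
            (Literature.AlgebraicTopology.SingularHomology.singularHomology ℚ ℚ X k)) :=
  fun hBase g l X _ _ _ _ _ _ hX =>
    ⟨stub_isLefschetzHandlebody_homology_connected g l X hX,
      stub_isLefschetzHandlebody_homology_H1 g l X hX, fun hspan hlen =>
        stub_isLefschetzHandlebody_homology_acyclic_of_base g l X hX (hBase g) hspan hlen⟩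

/-! ## §5 NF5 -/

/-- **NF5 = `LefschetzBase.isLefschetzHandlebody_homology` (Gompf–Stipsicz 1999 §8.2; Kas 1980),
PROVED**: for every genus `g`, word `l` and compact Lefschetz handlebody `X = X(F_{g,1}; l)` over
the standard base, `X` is connected, `H₁(X; ℤ) ≅ ℤ^{2g} ⧸ ⟨letters of l⟩`, and `X` is
`ℚ`-acyclic in positive degrees when the letters span `ℚ^{2g}` and `l` has `2g` letters — the
registered text of the parent stub `stub_isLefschetzHandlebody_homology` of line
`modp-braid-orbits` r9, from `stub_isLefschetzHandlebody_homology_of_base` and the vanishing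
`Hₖ(Base g) = 0`, `k ≥ 2` (`isZero_singularHomology_base_of_two_le`, `LefschetzBaseBetti.lean`).
[cite: GompfStipsicz1999, §8.2] [cite: Kas1980] -/
theorem stub_isLefschetzHandlebody_homology :
    ∀ (g : ℕ) (l : List ((Fin g ⊕ Fin g → ℤ) × Bool)) (X : Type) [TopologicalSpace X] [T2Space X]
      [SecondCountableTopology X] [CompactSpace X] [ChartedSpace (EuclideanHalfSpace 4) X]
      [IsManifold (𝓡∂ 4) ∞ X],
      IsLefschetzHandlebody g l X →
      ConnectedSpace X ∧
        Nonempty ((singularHomology ℤ ℤ X 1) ≃ₗ[ℤ]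
          ((Fin g ⊕ Fin g → ℤ) ⧸ Submodule.span ℤ (letters l))) ∧
        (Submodule.span ℚ (letters (ratWord l)) = ⊤ → l.length = 2 * g →
          ∀ k, 0 < k → CategoryTheory.Limits.IsZero (singularHomology ℚ ℚ X k)) :=
  stub_isLefschetzHandlebody_homology_of_base fun g k =>
    isZero_singularHomology_base_of_two_le ℚ ℚ g (Nat.le_add_left 2 k)

/-- **Discharge of the named fact `LefschetzBase.isLefschetzHandlebody_homology`** (NF5 of crux
`ConvexBisection.AcyclicBisectionExists`, `LefschetzModelFacts.lean`).
[cite: GompfStipsicz1999, §8.2] [cite: Kas1980] -/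
theorem isLefschetzHandlebody_homology_holds :
    Literature.Topology.FourManifolds.LefschetzBase.isLefschetzHandlebody_homology :=
  stub_isLefschetzHandlebody_homology

end Summit.SmoothPoincare4.SmoothPoincare4.Theorems.AcyclicBisectionExists.ModpBraidOrbits
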